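import Literature.NumberTheory.LFunctions.LagariasXiShiftHermiteBiehler
import Literature.NumberTheory.LFunctions.RiemannXiHadamardProduct
import HarnessLib

/-!
# Proof of Lagarias' Hermite–Biehler inequality for the shifted `ξ` (Lagarias 2005, Lemma 2.1 (1))

Discharge of the named fact `Literature.NumberTheory.LFunctions.lagarias2005_lemma_2_1`
(`LagariasXiShiftHermiteBiehler.lean`):

> **Lemma 2.1 (1)** (J. C. Lagarias, *Zero spacing distributions for differenced L-functions*,
> Acta Arith. 120 (2005) 159–184 = arXiv:math/0601653, §2, p. 4 of the arXiv version).
> If `h ≥ 1/2`, then `|ξ(h + s)| > |ξ(h + 1 − s̄)|` for `Re(s) > 1/2`.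

## The printed proof and how it is followed here

Lagarias proves the inequality *term by term* in the (modified) Hadamard product
`ξ(s) = e^{A* + B*s} ∏*_ρ (1 − s/ρ)` [Lagarias2005, §2, the display before Lemma 2.1]: the
exponential factor has `B* = 0`,
and for each zero `ρ = β + iγ` of `ξ` (`0 < β < 1`), with `s = σ + it`, `σ > 1/2`,

  `|1 − (h+s)/ρ| > |1 − (h+1−s̄)/ρ|  ⇔  |β − h − σ| > |β − h − (1 − σ)|`
  [Lagarias2005, proof of Lemma 2.1, the two numbered displays],

which holds because `β − h − 1/2 < 0 < σ − 1/2` (strict triangle inequality for two non-zero reals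
of opposite signs).

We follow exactly this argument, using the tree's PROVED grouped Hadamard product of `ξ`
(`RiemannXiHadamardProduct.lean`, from the genus-zero Hadamard theorem applied to de Bruijn's
`H₀`): for a Hadamard sequence `b` of `H₀`
(`Literature.NumberTheory.LFunctions.exists_isHadamardSeq`),

  `ξ(s) = ξ(½) ∏ₙ (1 − bₙ(2s−1)²)`,  `1 − bₙ(2s−1)² = −4bₙ (s − ρₙ)(s − (1 − ρₙ))` (`bₙ ≠ 0`),

with `ρₙ`, `1 − ρₙ` nontrivial zeros of `ζ` (`0 < Re ρₙ < 1`,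
`Literature.NumberTheory.LFunctions.IsHadamardSeq.riemannZeta_xiZero`).  The pairing `ρ ↔ 1 − ρ`
is Lagarias' "suitable order" making the product absolutely convergent, and there is no
exponential factor at all.  Lagarias' one-zero comparison is
`Literature.NumberTheory.LFunctions.norm_shift_reflect_sub_lt`; applied to `ρₙ` and to `1 − ρₙ` it
gives the strict factor-wise inequality
`Literature.NumberTheory.LFunctions.IsHadamardSeq.norm_factor_shift_reflect_lt`.  To pass from the
factors to the infinite product with a STRICT inequality we use the tree's logarithmic form
`Literature.NumberTheory.LFunctions.IsHadamardSeq.hasSum_log_norm_factors_sub`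
(`log|ξ(u)| − log|ξ(v)| = ∑ₙ [log|fₙ(u)| − log|fₙ(v)|]`, valid when `ξ(u), ξ(v) ≠ 0`; if
`ξ(h + 1 − s̄) = 0` the inequality is trivial since `ξ(h + s) ≠ 0` for `Re(h + s) > 1`): all terms
are `≥ 0` and at least one is `> 0`, because some `bₙ ≠ 0` — `ξ` is not constant, e.g.
`ξ(2) = π/6 ≠ 1/2 = ξ(1)` (`Literature.NumberTheory.LFunctions.riemannXi_two`).

## Main result

* `Literature.NumberTheory.LFunctions.lagarias2005_lemma_2_1_holds : lagarias2005_lemma_2_1`.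

## References

* [Lagarias2005] J. C. Lagarias, *Zero spacing distributions for differenced L-functions*,
  Acta Arith. 120 (2005), no. 2, 159–184, doi:10.4064/aa120-2-4 = arXiv:math/0601653;
  Lemma 2.1 and its proof, §2 (arXiv version p. 4), restated as Lemma 6.1 (i).
* D. H. J. Polymath, *Effective approximation of heat flow evolution of the Riemann ξ function,
  and a new upper bound for the de Bruijn–Newman constant*, Res. Math. Sci. 6 (2019), §3
  (grouped Hadamard product).  [Polymath2019]
-/

noncomputable section

open Complex
open scoped ComplexConjugate

namespace Literature.NumberTheory.LFunctions

/-! ## Non-constancy of `ξ`: `ξ(2) = π/6` -/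

/-- `ξ(2) = ½·2·1·π⁻¹·Γ(1)·ζ(2) = π/6`. [folklore] -/
theorem riemannXi_two : riemannXi 2 = (Real.pi : ℂ) / 6 := by
  have h2 : (2 : ℂ) ≠ 0 := two_ne_zero
  rw [riemannXi_eq_mul_completedRiemannZeta h2 (by norm_num)]
  have hπ : (Real.pi : ℂ) ≠ 0 := ofReal_ne_zero.2 Real.pi_pos.ne'
  have hΓ : Gammaℝ 2 = (Real.pi : ℂ)⁻¹ := by
    rw [Gammaℝ_def, show (-2 : ℂ) / 2 = -1 by norm_num, show (2 : ℂ) / 2 = 1 by norm_num,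
      Complex.Gamma_one, mul_one, cpow_neg_one]
  have hΓ0 : Gammaℝ 2 ≠ 0 := by rw [hΓ]; exact inv_ne_zero hπ
  have hΛ : completedRiemannZeta 2 = Gammaℝ 2 * riemannZeta 2 := by
    rw [riemannZeta_def_of_ne_zero h2, mul_div_cancel₀ _ hΓ0]
  rw [hΛ, hΓ, riemannZeta_two]
  field_simp
  ring

/-- `ξ` is not constant: `ξ(2) ≠ ξ(1)` (`π/6 ≠ 1/2`). [folklore] -/
theorem riemannXi_two_ne_riemannXi_one : riemannXi 2 ≠ riemannXi 1 := by
  rw [riemannXi_two, riemannXi_one]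
  intro h
  have h' : (Real.pi : ℂ) = (3 : ℝ) := by
    push_cast
    linear_combination 6 * h
  have h3 : Real.pi = 3 := by exact_mod_cast h'
  have := Real.pi_gt_three
  linarith

/-! ## Lagarias' one-zero comparison [Lagarias2005, proof of Lemma 2.1] -/

/-- **Lagarias' one-zero inequality** (proof of Lemma 2.1: "`|β − h − σ| > |β − h − (1 − σ)|`"):
for `ρ` with `Re ρ < h + 1/2` and `s` with `Re s > 1/2`,
`|h + 1 − s̄ − ρ| < |h + s − ρ|`.  Indeed both numbers have imaginary part `Im s − Im ρ`, and with
`β = Re ρ`, `σ = Re s`: `|β − h − (1 − σ)| < |β − h − σ|` since `β − h − 1/2 < 0 < σ − 1/2`.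
[cite: Lagarias2005, Lemma 2.1, proof of part (1)] -/
theorem norm_shift_reflect_sub_lt {h : ℝ} {s ρ : ℂ} (hs : 1 / 2 < s.re) (hρ : ρ.re < h + 1 / 2) :
    ‖(h : ℂ) + 1 - conj s - ρ‖ < ‖(h : ℂ) + s - ρ‖ := by
  refine (sq_lt_sq₀ (norm_nonneg _) (norm_nonneg _)).1 ?_
  rw [Complex.sq_norm, Complex.sq_norm, Complex.normSq_apply, Complex.normSq_apply]
  simp only [add_re, sub_re, ofReal_re, one_re, conj_re, add_im, sub_im, ofReal_im, one_im,
    conj_im]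
  nlinarith [mul_pos (sub_pos.2 hs) (sub_pos.2 hρ), sq_nonneg (s.im - ρ.im)]

namespace IsHadamardSeq

variable {b : ℕ → ℂ}

/-- A Hadamard sequence of `H₀` is not identically zero (otherwise `ξ ≡ ξ(½)`, but
`ξ(2) ≠ ξ(1)`); i.e. `ξ` has at least one zero. [folklore] -/
theorem exists_ne_zero (h : IsHadamardSeq 0 b) : ∃ n, b n ≠ 0 := by
  by_contra hb
  push Not at hb
  have hconst : ∀ s, riemannXi s = riemannXi (1 / 2) := fun s ↦ by
    rw [h.riemannXi_eq_mul_tprod s]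
    simp [hb]
  exact riemannXi_two_ne_riemannXi_one ((hconst 2).trans (hconst 1).symm)

/-- **The factor-wise strict inequality** (Lagarias' term-by-term step, for the grouped factor
`fₙ(s) = 1 − bₙ(2s−1)² = −4bₙ(s − ρₙ)(s − (1 − ρₙ))`, `bₙ ≠ 0`): for `h ≥ 1/2` and `Re s > 1/2`,
`|fₙ(h + 1 − s̄)| < |fₙ(h + s)|` — `norm_shift_reflect_sub_lt` at the nontrivial zeros `ρₙ` and
`1 − ρₙ` (both with real part `< 1 ≤ h + 1/2`).
[cite: Lagarias2005, Lemma 2.1, proof of part (1)] -/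
theorem norm_factor_shift_reflect_lt (hb : IsHadamardSeq 0 b) {n : ℕ} (hn : b n ≠ 0) {h : ℝ}
    (hh : 1 / 2 ≤ h) {s : ℂ} (hs : 1 / 2 < s.re) :
    ‖1 - b n * (2 * ((h : ℂ) + 1 - conj s) - 1) ^ 2‖ <
      ‖1 - b n * (2 * ((h : ℂ) + s) - 1) ^ 2‖ := by
  have hρ := hb.riemannZeta_xiZero hn
  rw [factor_eq_mul b hn, factor_eq_mul b hn]
  simp only [norm_mul]
  have h4 : 0 < ‖(-4 : ℂ)‖ * ‖b n‖ :=
    mul_pos (norm_pos_iff.2 (by norm_num)) (norm_pos_iff.2 hn)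
  refine mul_lt_mul_of_pos_left ?_ h4
  have h1 : ‖(h : ℂ) + 1 - conj s - xiZero b n‖ < ‖(h : ℂ) + s - xiZero b n‖ :=
    norm_shift_reflect_sub_lt hs (by linarith [hρ.2.2])
  have h2 : ‖(h : ℂ) + 1 - conj s - (1 - xiZero b n)‖ < ‖(h : ℂ) + s - (1 - xiZero b n)‖ :=
    norm_shift_reflect_sub_lt hs (by simp only [sub_re, one_re]; linarith [hρ.2.1])
  exact mul_lt_mul'' h1 h2 (norm_nonneg _) (norm_nonneg _)

end IsHadamardSeq

/-! ## The theorem -/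

/-- **Lagarias 2005, Lemma 2.1 (1)** (discharge of `lagarias2005_lemma_2_1`): for every real
`h ≥ 1/2` and every `s` with `Re s > 1/2`, `|ξ(h + 1 − s̄)| < |ξ(h + s)|`.  Proof as printed: term
by term in the Hadamard product of `ξ` (here the tree's grouped product over the pairs
`{ρ, 1 − ρ}`), the strictness being carried through the infinite product by the logarithmic
series `log|ξ(u)| − log|ξ(v)| = ∑ₙ [log|fₙ(u)| − log|fₙ(v)|]` with non-negative terms, one of
which is positive. [cite: Lagarias2005, Lemma 2.1 (1) and its proof, §2] -/
theorem lagarias2005_lemma_2_1_holds : lagarias2005_lemma_2_1 := by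
  intro h hh s hs
  -- `u = h + s` has `Re u > 1`, so `ξ(u) ≠ 0`
  have hu : riemannXi ((h : ℂ) + s) ≠ 0 := fun h0 ↦ by
    have := ((riemannXi_eq_zero_iff_holds _).1 h0).2.2
    simp only [add_re, ofReal_re] at this
    linarith
  -- if `ξ(v) = 0` (`v = h + 1 − s̄`) there is nothing to prove
  by_cases hv : riemannXi ((h : ℂ) + 1 - conj s) = 0
  · rw [hv, norm_zero]; exact norm_pos_iff.2 hu
  -- otherwise compare the logarithms through the Hadamard product
  obtain ⟨b, hb⟩ := exists_isHadamardSeq 0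
  obtain ⟨n₀, hn₀⟩ := hb.exists_ne_zero
  have hsum := hb.hasSum_log_norm_factors_sub hu hv
  have hterm : ∀ n, b n ≠ 0 →
      0 < Real.log ‖1 - b n * (2 * ((h : ℂ) + s) - 1) ^ 2‖ -
        Real.log ‖1 - b n * (2 * ((h : ℂ) + 1 - conj s) - 1) ^ 2‖ := by
    intro n hn
    have hlt := hb.norm_factor_shift_reflect_lt hn hh hs
    have hpos : 0 < ‖1 - b n * (2 * ((h : ℂ) + 1 - conj s) - 1) ^ 2‖ :=
      norm_pos_iff.2 (hb.factor_ne_zero' hv n)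
    have := Real.log_lt_log hpos hlt
    linarith
  have hle : (fun _ : ℕ ↦ (0 : ℝ)) ≤ fun n ↦ Real.log ‖1 - b n * (2 * ((h : ℂ) + s) - 1) ^ 2‖ -
      Real.log ‖1 - b n * (2 * ((h : ℂ) + 1 - conj s) - 1) ^ 2‖ := by
    intro n
    by_cases hn : b n = 0
    · simp [hn]
    · exact (hterm n hn).le
  have hpos : (0 : ℝ) < Real.log ‖riemannXi ((h : ℂ) + s)‖ -
      Real.log ‖riemannXi ((h : ℂ) + 1 - conj s)‖ :=
    hasSum_lt hle (hterm n₀ hn₀) hasSum_zero hsum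
  have hv' : 0 < ‖riemannXi ((h : ℂ) + 1 - conj s)‖ := norm_pos_iff.2 hv
  have hu' : 0 < ‖riemannXi ((h : ℂ) + s)‖ := norm_pos_iff.2 hu
  rw [← Real.log_lt_log_iff hv' hu']
  linarith

end Literature.NumberTheory.LFunctions
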